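import Mathlib.Data.List.Lex
import Literature.Computability.Complexity.GraphSwapBricks
import HarnessLib

/-!
# Lexicographic comparison bricks: `lexLeFn ⟨a, b⟩ = [a ≤ b]` and `lexMinFn ⟨a, b⟩ = min a b` in `FP`

Toolkit in the `FP` string-algebra style of `BrickAlgebra.lean` (records, `fanoutFn`, `iteFn`,
clocked iteration `iterate_mem_FP`), written for the discharge programme of
`babaiLuks1983_canonicalForm` (`GraphCanonizationLeader.lean`: the canonical form is the
lexicographic LEADER — the least code in Mathlib's lexicographic order on `List Bool`, `[] < b :: l`,
`false < true` — over a set of candidate codes, so the machine must compare codes in exactly this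
order; the value tests `ltFn` of `StackBricks.lean` compare little-endian numerals instead).

* `LexCmp.lexLeB a b` — the comparison as a structural recursion (pop equal heads; decide on the
  first difference or exhaustion), and `lexLeB_eq : lexLeB a b = decide (a ≤ b)`;
* the loop: records `⟨x, ⟨u, ⟨v, r⟩⟩⟩` (clock copy `x = a`, remainders `u`, `v`, verdict `r = ε`
  while undecided), one round `lexStep` (in `FP`, output at most `7` symbols longer), its runs
  (`iterate_lexStep`);
* **`LexCmp.lexLeFn ∈ FP`** with **`lexLeFn ⟨a, b⟩ = [decide (a ≤ b)]`**, and
  **`LexCmp.lexMinFn ∈ FP`** with **`lexMinFn ⟨a, b⟩ = min a b`**.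

## References

* S. Arora, B. Barak, *Computational Complexity: A Modern Approach*, CUP 2009, §1.3 (polynomial
  time is closed under composition and bounded loops).
* L. Babai, E. M. Luks, *Canonical labeling of graphs*, STOC 1983, §1 ("lexicographic leader").
  [BabaiLuks1983]
-/

namespace Literature.Computability.Complexity

open _root_.Computability Polynomial Brick Plumb

namespace LexCmp

/-! ### The lexicographic order on bit strings, structurally -/

/-- Lexicographic `≤` on bit strings as a structural recursion: `ε ≤ b`; `a :: u ≰ ε`; equal heads
are popped; at the first difference the answer is the head of the second string. [folklore] -/
def lexLeB : List Bool → List Bool → Bool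
  | [], _ => true
  | _ :: _, [] => false
  | a :: u, b :: v => if a = b then lexLeB u v else b

/-- `<` on lists is `List.Lex (· < ·)` (Mathlib's `LinearOrder (List α)`). [folklore] -/
theorem lt_iff_lex (a b : List Bool) : a < b ↔ List.Lex (· < ·) a b := Iff.rfl

/-- `ε` is the least bit string. [folklore] -/
theorem nil_le (v : List Bool) : ([] : List Bool) ≤ v := by
  rcases v with _ | ⟨b, v⟩
  · exact le_rfl
  · exact le_of_lt ((lt_iff_lex _ _).2 List.Lex.nil)

/-- A nonempty string is not below `ε`. [folklore] -/
theorem not_cons_le_nil (a : Bool) (u : List Bool) : ¬ (a :: u ≤ ([] : List Bool)) := by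
  intro h
  rcases h.lt_or_eq with h | h
  · have h' := (lt_iff_lex _ _).1 h
    nomatch h'
  · exact List.cons_ne_nil _ _ h

/-- Equal heads: `a :: u ≤ a :: v ↔ u ≤ v`. [folklore] -/
theorem cons_le_cons_iff (a : Bool) (u v : List Bool) : (a :: u ≤ a :: v) ↔ u ≤ v := by
  rw [le_iff_lt_or_eq, le_iff_lt_or_eq, lt_iff_lex, lt_iff_lex, List.lex_cons_iff, List.cons.injEq]
  simp

/-- Different heads: `a :: u ≤ b :: v ↔ a < b`. [folklore] -/
theorem cons_le_cons_iff_of_ne {a b : Bool} (h : a ≠ b) (u v : List Bool) : (a :: u ≤ b :: v) ↔ a < b := by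
  rw [le_iff_lt_or_eq, lt_iff_lex, List.cons.injEq]
  constructor
  · rintro (hl | ⟨rfl, -⟩)
    · cases hl with
      | cons h' => exact absurd rfl h
      | rel h' => exact h'
    · exact absurd rfl h
  · exact fun hab => Or.inl (List.Lex.rel hab)

/-- **The structural comparison is the lexicographic order.** [folklore] -/
theorem lexLeB_eq : ∀ (a b : List Bool), lexLeB a b = decide (a ≤ b)
  | [], v => by rw [lexLeB, decide_eq_true (nil_le v)]
  | a :: u, [] => by rw [lexLeB, decide_eq_false (not_cons_le_nil a u)]
  | a :: u, b :: v => by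
    rw [lexLeB]
    by_cases hab : a = b
    · subst hab
      rw [if_pos rfl, lexLeB_eq u v, Bool.decide_congr (cons_le_cons_iff a u v).symm]
    · rw [if_neg hab, Bool.decide_congr (cons_le_cons_iff_of_ne hab u v)]
      cases a <;> cases b <;> simp_all

/-! ### Records `⟨x, ⟨u, ⟨v, r⟩⟩⟩` and one round -/

/-- The loop record. [folklore] -/
def rec4 (x u v r : List Bool) : List Bool := boolPair x (boolPair u (boolPair v r))

/-- Field `x`. [folklore] -/
@[simp] theorem nthF_zero_rec4 (x u v r : List Bool) : nthF 0 (rec4 x u v r) = x := by simp [rec4]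
/-- Field `u`. [folklore] -/
@[simp] theorem nthF_one_rec4 (x u v r : List Bool) : nthF 1 (rec4 x u v r) = u := by simp [rec4]
/-- Field `v`. [folklore] -/
@[simp] theorem nthF_two_rec4 (x u v r : List Bool) : nthF 2 (rec4 x u v r) = v := by simp [rec4]
/-- Field `r`. [folklore] -/
@[simp] theorem sndPow_two_rec4 (x u v r : List Bool) : sndPow 2 (rec4 x u v r) = r := by simp [rec4]
/-- The clock field through `boolUnpair`. [folklore] -/
@[simp] theorem boolUnpair_rec4_fst (x u v r : List Bool) : (boolUnpair (rec4 x u v r)).1 = x := by simp [rec4]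

/-- Replace the verdict field by `w z`: `⟨x, ⟨u, ⟨v, w z⟩⟩⟩`. [folklore] -/
noncomputable def setR (w : List Bool → List Bool) : List Bool → List Bool :=
  fanoutFn (nthF 0) (fanoutFn (nthF 1) (fanoutFn (nthF 2) w))

/-- `setR w ∈ FP` for `w ∈ FP`. [folklore] -/
theorem setR_mem_FP {w : List Bool → List Bool} (hw : w ∈ FP) : setR w ∈ FP :=
  fanoutFn_mem_FP (nthF_mem_FP 0) (fanoutFn_mem_FP (nthF_mem_FP 1) (fanoutFn_mem_FP (nthF_mem_FP 2) hw))

/-- `setR` on a record. [folklore] -/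
theorem setR_rec4 (w : List Bool → List Bool) (x u v r : List Bool) :
    setR w (rec4 x u v r) = rec4 x u v (w (rec4 x u v r)) := by
  simp [setR, rec4]

/-- The tail of a bit string, `dropFn ⟨1, ·⟩`. [folklore] -/
noncomputable def tailFn : List Bool → List Bool := dropFn ∘ fanoutFn (fun _ => [true]) id

/-- `tailFn w = w.tail`. [folklore] -/
@[simp] theorem tailFn_apply (w : List Bool) : tailFn w = w.drop 1 := by simp [tailFn]

/-- `tailFn ∈ FP`. [folklore] -/
theorem tailFn_mem_FP : tailFn ∈ FP :=
  comp_mem_FP dropFn_mem_FP (fanoutFn_mem_FP (const_mem_FP _) OracleCompose.id_mem_FP)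

/-- Pop both heads: `⟨x, ⟨u⇂1, ⟨v⇂1, ε⟩⟩⟩`. [folklore] -/
noncomputable def popBoth : List Bool → List Bool :=
  fanoutFn (nthF 0) (fanoutFn (tailFn ∘ nthF 1) (fanoutFn (tailFn ∘ nthF 2) fun _ => []))

/-- `popBoth ∈ FP`. [folklore] -/
theorem popBoth_mem_FP : popBoth ∈ FP :=
  fanoutFn_mem_FP (nthF_mem_FP 0) (fanoutFn_mem_FP (comp_mem_FP tailFn_mem_FP (nthF_mem_FP 1))
    (fanoutFn_mem_FP (comp_mem_FP tailFn_mem_FP (nthF_mem_FP 2)) (const_mem_FP _)))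

/-- `popBoth` on a record. [folklore] -/
theorem popBoth_rec4 (x u v r : List Bool) : popBoth (rec4 x u v r) = rec4 x (u.drop 1) (v.drop 1) [] := by
  simp [popBoth, rec4]

/-- **The comparison round** (on an undecided record): `u = ε` ⇒ verdict `1`; else `v = ε` ⇒ `0`;
else equal heads ⇒ pop both; else verdict = head of `v`. [folklore] -/
noncomputable def cmpStep : List Bool → List Bool :=
  iteFn (isNilFn ∘ nthF 1) (setR fun _ => [true])
    (iteFn (isNilFn ∘ nthF 2) (setR fun _ => [false])
      (iteFn (eqPairFn ∘ fanoutFn (take1Fn ∘ nthF 1) (take1Fn ∘ nthF 2)) popBoth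
        (setR (take1Fn ∘ nthF 2))))

/-- `cmpStep ∈ FP`. [cite: AroraBarak2009, §1.3] -/
theorem cmpStep_mem_FP : cmpStep ∈ FP :=
  iteFn_mem_FP (comp_mem_FP isNilFn_mem_FP (nthF_mem_FP 1)) (setR_mem_FP (const_mem_FP _))
    (iteFn_mem_FP (comp_mem_FP isNilFn_mem_FP (nthF_mem_FP 2)) (setR_mem_FP (const_mem_FP _))
      (iteFn_mem_FP (comp_mem_FP eqPairFn_mem_FP
          (fanoutFn_mem_FP (comp_mem_FP take1Fn_mem_FP (nthF_mem_FP 1)) (comp_mem_FP take1Fn_mem_FP (nthF_mem_FP 2))))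
        popBoth_mem_FP (setR_mem_FP (comp_mem_FP take1Fn_mem_FP (nthF_mem_FP 2)))))

/-- **One round of the loop**: act by `cmpStep` while the verdict is `ε`, else keep. [folklore] -/
noncomputable def lexStep : List Bool → List Bool := iteFn (isNilFn ∘ sndPow 2) cmpStep id

/-- `lexStep ∈ FP`. [cite: AroraBarak2009, §1.3] -/
theorem lexStep_mem_FP : lexStep ∈ FP :=
  iteFn_mem_FP (comp_mem_FP isNilFn_mem_FP (sndPow_mem_FP 2)) cmpStep_mem_FP OracleCompose.id_mem_FP

/-- Equality tests after a map are one-bit conditions. [folklore] -/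
theorem oneBit_isNilFn_comp (g : List Bool → List Bool) : OneBit (isNilFn ∘ g) := oneBit_isNilFn.comp g

/-! ### Values of one round -/

/-- A decided record is kept. [folklore] -/
theorem lexStep_decided (x u v : List Bool) (b : Bool) (r : List Bool) :
    lexStep (rec4 x u v (b :: r)) = rec4 x u v (b :: r) := by
  rw [lexStep, iteFn_apply_false]
  · rfl
  · simp [isNilFn]

/-- On an undecided record the round is `cmpStep`. [folklore] -/
theorem lexStep_undecided (x u v : List Bool) : lexStep (rec4 x u v []) = cmpStep (rec4 x u v []) := by
  rw [lexStep, iteFn_apply_true]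
  simp [isNilFn]

/-- `u = ε`: verdict `1`. [folklore] -/
theorem cmpStep_nil_left (x v : List Bool) : cmpStep (rec4 x [] v []) = rec4 x [] v [true] := by
  rw [cmpStep, iteFn_apply_true, setR_rec4]
  simp [isNilFn]

/-- `u ≠ ε`, `v = ε`: verdict `0`. [folklore] -/
theorem cmpStep_cons_nil (x : List Bool) (a : Bool) (u : List Bool) :
    cmpStep (rec4 x (a :: u) [] []) = rec4 x (a :: u) [] [false] := by
  rw [cmpStep, iteFn_apply_false, iteFn_apply_true, setR_rec4]
  · simp [isNilFn]
  · simp [isNilFn]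

/-- Equal heads: pop both. [folklore] -/
theorem cmpStep_cons_cons_eq (x : List Bool) (a : Bool) (u v : List Bool) :
    cmpStep (rec4 x (a :: u) (a :: v) []) = rec4 x u v [] := by
  rw [cmpStep, iteFn_apply_false, iteFn_apply_false, iteFn_apply_true, popBoth_rec4]
  · rfl
  · simp [take1Fn, eqPairFn_boolPair]
  · simp [isNilFn]
  · simp [isNilFn]

/-- Different heads: verdict = head of `v`. [folklore] -/
theorem cmpStep_cons_cons_ne (x : List Bool) {a b : Bool} (h : a ≠ b) (u v : List Bool) :
    cmpStep (rec4 x (a :: u) (b :: v) []) = rec4 x (a :: u) (b :: v) [b] := by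
  rw [cmpStep, iteFn_apply_false, iteFn_apply_false, iteFn_apply_false, setR_rec4]
  · simp [take1Fn]
  · simp [take1Fn, eqPairFn_boolPair, h]
  · simp [isNilFn]
  · simp [isNilFn]

/-- A decided record is a fixed point of all later rounds. [folklore] -/
theorem iterate_lexStep_decided (x u v : List Bool) (b : Bool) (r : List Bool) (t : ℕ) :
    lexStep^[t] (rec4 x u v (b :: r)) = rec4 x u v (b :: r) :=
  Function.iterate_fixed (lexStep_decided x u v b r) t

/-- **Runs of the loop**: after at least `|u| + 1` rounds from an undecided record the verdict
field is `[lexLeB u v]`. [folklore] -/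
theorem iterate_lexStep : ∀ (u v x : List Bool) (t : ℕ), u.length + 1 ≤ t →
    ∃ u' v', lexStep^[t] (rec4 x u v []) = rec4 x u' v' [lexLeB u v]
  | [], v, x, t, ht => by
    obtain ⟨t, rfl⟩ : ∃ t', t = t' + 1 := ⟨t - 1, by omega⟩
    refine ⟨[], v, ?_⟩
    rw [Function.iterate_succ_apply, lexStep_undecided, cmpStep_nil_left, iterate_lexStep_decided, lexLeB]
  | a :: u, [], x, t, ht => by
    obtain ⟨t, rfl⟩ : ∃ t', t = t' + 1 := ⟨t - 1, by omega⟩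
    refine ⟨a :: u, [], ?_⟩
    rw [Function.iterate_succ_apply, lexStep_undecided, cmpStep_cons_nil, iterate_lexStep_decided, lexLeB]
  | a :: u, b :: v, x, t, ht => by
    obtain ⟨t, rfl⟩ : ∃ t', t = t' + 1 := ⟨t - 1, by omega⟩
    by_cases hab : a = b
    · subst hab
      obtain ⟨u', v', h⟩ := iterate_lexStep u v x t (by simp at ht; omega)
      refine ⟨u', v', ?_⟩
      rw [Function.iterate_succ_apply, lexStep_undecided, cmpStep_cons_cons_eq, h, lexLeB, if_pos rfl]
    · refine ⟨a :: u, b :: v, ?_⟩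
      rw [Function.iterate_succ_apply, lexStep_undecided, cmpStep_cons_cons_ne x hab, iterate_lexStep_decided,
        lexLeB, if_neg hab]

/-! ### Growth of one round -/

/-- The three record fields are short: `2|x| + 2|u| + 2|v| + |r| ≤ |w|` for the projections of ANY
string `w`. [folklore] -/
theorem fields_le (w : List Bool) :
    2 * (nthF 0 w).length + 2 * (nthF 1 w).length + 2 * (nthF 2 w).length + (sndPow 2 w).length ≤ w.length := by
  have h0 := length_fstF_sndF_le w
  have h1 := length_fstF_sndF_le (sndF w)
  have h2 := length_fstF_sndF_le (sndF (sndF w))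
  simp only [nthF, sndPow, Function.comp_apply] at *
  omega

/-- `setR w` with a one-symbol-or-less verdict grows by at most `7`. [folklore] -/
theorem length_setR_le {c : List Bool → List Bool} (hc : ∀ z, (c z).length ≤ 1) (w : List Bool) :
    (setR c w).length ≤ w.length + 7 := by
  have := fields_le w
  have := hc w
  simp only [setR, fanoutFn_apply, length_boolPair]
  omega

/-- `popBoth` grows by at most `6`. [folklore] -/
theorem length_popBoth_le (w : List Bool) : (popBoth w).length ≤ w.length + 6 := by
  have := fields_le w
  simp only [popBoth, fanoutFn_apply, length_boolPair, Function.comp_apply, tailFn_apply, List.length_nil,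
    List.length_drop]
  omega

/-- **One round grows the record by at most `7` symbols** (on every input). [folklore] -/
theorem length_lexStep_le (w : List Bool) : (lexStep w).length ≤ w.length + 7 := by
  rw [lexStep, iteFn_of_oneBit (oneBit_isNilFn_comp _)]
  split_ifs
  · rw [cmpStep, iteFn_of_oneBit (oneBit_isNilFn_comp _)]
    split_ifs
    · exact length_setR_le (fun _ => le_rfl) w
    rw [iteFn_of_oneBit (oneBit_isNilFn_comp _)]
    split_ifs
    · exact length_setR_le (fun _ => le_rfl) w
    rw [iteFn_of_oneBit (GraphSwap.oneBit_eqPairFn_comp _)]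
    split_ifs
    · exact (length_popBoth_le w).trans (by omega)
    · exact length_setR_le (fun z => by simp [take1Fn]) w
  · simp

/-! ### The bricks -/

/-- The initial record `⟨a, ⟨a, ⟨b, ε⟩⟩⟩` from `⟨a, b⟩`. [folklore] -/
noncomputable def lexInit : List Bool → List Bool := fanoutFn fstF (fanoutFn fstF (fanoutFn sndF fun _ => []))

/-- `lexInit ∈ FP`. [folklore] -/
theorem lexInit_mem_FP : lexInit ∈ FP :=
  fanoutFn_mem_FP fstF_mem_FP (fanoutFn_mem_FP fstF_mem_FP (fanoutFn_mem_FP sndF_mem_FP (const_mem_FP _)))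

/-- `lexInit ⟨a, b⟩ = ⟨a, ⟨a, ⟨b, ε⟩⟩⟩`. [folklore] -/
theorem lexInit_boolPair (a b : List Bool) : lexInit (boolPair a b) = rec4 a a b [] := by
  simp [lexInit, rec4]

/-- **The comparison brick** `lexLeFn`: `|a| + 1` clocked rounds of `lexStep`, then the verdict
field. [cite: AroraBarak2009, §1.3 (bounded loops)] -/
noncomputable def lexLeFn : List Bool → List Bool :=
  sndPow 2 ∘ (fun z => lexStep^[(X + 1 : Polynomial ℕ).eval (boolUnpair z).1.length] z) ∘ lexInit

/-- **`lexLeFn ∈ FP`.** [cite: AroraBarak2009, §1.3 (bounded loops)] -/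
theorem lexLeFn_mem_FP : lexLeFn ∈ FP :=
  comp_mem_FP (sndPow_mem_FP 2)
    (comp_mem_FP (iterate_mem_FP lexStep_mem_FP 7 length_lexStep_le (X + 1)) lexInit_mem_FP)

/-- **`lexLeFn ⟨a, b⟩ = [decide (a ≤ b)]`** (Mathlib's lexicographic order on `List Bool`). [folklore] -/
@[simp] theorem lexLeFn_boolPair (a b : List Bool) : lexLeFn (boolPair a b) = [decide (a ≤ b)] := by
  obtain ⟨u', v', h⟩ := iterate_lexStep a b a (a.length + 1) le_rfl
  simp only [lexLeFn, Function.comp_apply, lexInit_boolPair, boolUnpair_rec4_fst, eval_add, eval_X, eval_one]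
  rw [h, sndPow_two_rec4, lexLeB_eq]

/-- The comparison brick is a one-bit condition on pairs. [folklore] -/
theorem lexLeFn_boolPair_eq_or (a b : List Bool) :
    lexLeFn (boolPair a b) = [true] ∨ lexLeFn (boolPair a b) = [false] := by
  rw [lexLeFn_boolPair]; cases decide (a ≤ b) <;> simp

/-- **The minimum brick** `lexMinFn ⟨a, b⟩ = min a b`. [cite: BabaiLuks1983, §1 (lexicographic leader)] -/
noncomputable def lexMinFn : List Bool → List Bool := iteFn lexLeFn fstF sndF

/-- **`lexMinFn ∈ FP`.** [cite: AroraBarak2009, §1.3] -/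
theorem lexMinFn_mem_FP : lexMinFn ∈ FP := iteFn_mem_FP lexLeFn_mem_FP fstF_mem_FP sndF_mem_FP

/-- **`lexMinFn ⟨a, b⟩ = min a b`.** [folklore] -/
@[simp] theorem lexMinFn_boolPair (a b : List Bool) : lexMinFn (boolPair a b) = min a b := by
  rw [lexMinFn, iteFn_apply (lexLeFn_boolPair a b), min_def]
  by_cases h : a ≤ b <;> simp [h]

end LexCmp

end Literature.Computability.Complexity
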